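import Summits.CriticalPhenomena.CardyFormulaZ2.Theorems.CardyComplexConeEdgePrecompactUFRSJunctionFunnelTransition
import Literature.Probability.Percolation.AnnulusCircuitsProofs

/-!
# The junction funnel, part C: the abstract funnel
(line `qkz-strip-boundary-arm` of crux `CardyComplexCone.EdgePrecompact`, stmt-CriticalPhenomena-11387;
third file of the registered sub-goal S2 = `ufrs_junctionFunnel`, lead c5, wave 4; registered
anchor `fence_funnel_JF`; continues `…UFRSJunctionFunnelTransition.lean`)

`fence_funnel_JF` — the deterministic core of the funnel, in the reference frame of the gate: a
configuration `β` on `ℤ²`, the lattice box `[I₀, I₁] × [J₀, J₁]` of the datum (faces of the box =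
inner faces), the arch of the gate — a lattice walk `P` from `v₀` with `β`-open darts inside the
box, ending at a vertex `p₁` outside the box, and a face walk `Q` from `cFace (v₀, k₀)` crossing
only `β`-closed edges, ending at a face `q₁` of the face row `J₀ - 1`, `P` inside
`{x₁ ≥ 2N} ∪ {|x₀| ≥ 2N}`, `Q` inside `{x₀ ≥ 2N} ∪ {x₀ + 1 ≤ -2N}`, feet on opposite sides of
the inner columns. Then every stretch of an orbit of `nextCorner β` through faces of the box,
with one end at a vertex of sup-norm `≤ 2N - 1` and the other at a vertex with abscissa `≤ -(M+2)`
or `≥ M + 2` or ordinate `≥ M + 2`, visits the corner `(v₀, k₀)`. Proof: the fence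
`Φ = (leg below q₁)⁻¹ ++ (scaled Q)⁻¹ ++ link ++ scaled P ++ (leg below p₁)` (legs = `downRun`s to
the row `2J₀ - 5`) has the edge typology of `fence_transition_JF`; below the box only the two
legs wind, and exactly one of them lies to the right of an inner column, so `walkWinding Φ = ±1`
around inner sample faces (`walkWinding_inner_JF`) and `0` around outer ones
(`walkWinding_outer_JF`); along a stretch avoiding `(v₀, k₀)` it is constant.

References: H. Kesten, *Percolation theory for mathematicians* (1982), §2.2; H. Kesten, Comm.
Math. Phys. 109 (1987), §2 (fences); S. Smirnov, C. R. Acad. Sci. Paris 333 (2001), §2.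
-/

set_option linter.unusedVariables false

namespace Summit.CriticalPhenomena.CardyFormulaZ2.Cruxes.EdgePrecompact.QkzStripBoundaryArm

open MeasureTheory Filter Set Metric
open scoped Topology BigOperators Pointwise
open Literature.Probability.LatticeModels Literature.Probability.Percolation
open Literature.Probability.RandomPlanarGeometry (DobrushinDomain)
open Summit.CriticalPhenomena.CardyFormulaZ2.Theses.CardyComplexCone

noncomputable section
/-! ## The abstract funnel -/

/-- An edge of a walk joins two support vertices. -/
theorem exists_eq_of_mem_edges_JF {V : Type*} {G : SimpleGraph V} {a b : V} {p : G.Walk a b} {e : Sym2 V}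
    (he : e ∈ p.edges) : ∃ x y, e = s(x, y) ∧ x ∈ p.support ∧ y ∈ p.support ∧ G.Adj x y := by
  rw [SimpleGraph.Walk.edges, List.mem_map] at he
  obtain ⟨d, hd, rfl⟩ := he
  exact ⟨d.fst, d.snd, rfl, p.dart_fst_mem_support_of_mem_darts hd, p.dart_snd_mem_support_of_mem_darts hd, d.adj⟩

/-- **The abstract funnel** (the deterministic core of S2). Data, in the reference frame scaled by
nothing yet: a configuration `β`; the lattice box `[I₀, I₁] × [J₀, J₁]` of the datum (its inner
faces are the unit squares inside); the scale `N` and a bound `M`; the arch of the gate read in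
the frame: a lattice walk `P` from `v₀` whose darts inside the box are `β`-open and whose last
vertex `p₁` is outside the box, a face walk `Q` from `f₀ = cFace (v₀, k₀)` crossing only
`β`-closed edges, whose last face `q₁` lies in the face row `J₀ - 1` just below the box, `P` in
the region `{x₁ ≥ 2N} ∪ {|x₀| ≥ 2N}`, `Q` in `{x₀ ≥ 2N} ∪ {x₀ + 1 ≤ -2N}`, the two feet on
opposite sides. Conclusion: every stretch `[i, j]` of an orbit of `nextCorner β` through faces
of the box with one end at a vertex of sup-norm `≤ 2N - 1` and the other end at a vertex with a
coordinate `≥ M + 2` in absolute value (or ordinate `≥ M + 2`) visits the corner `(v₀, k₀)`.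
Proof: the fence `Φ` = (leg below `q₁`)⁻¹ ++ (scaled `Q`)⁻¹ ++ link ++ scaled `P` ++ (leg below
`p₁`) satisfies the transition lemma `fence_transition_JF`, winds `±1` times around the scaled
sample faces of inner corners (`walkWinding_inner_JF`: below the box only the two legs count, and
exactly one of them is to the right) and `0` times around those of outer corners
(`walkWinding_outer_JF`); along a stretch avoiding `(v₀, k₀)` the winding number is constant. -/
theorem fence_funnel_JF : ∀ (β : BondConfig (Site 2)) (N I₀ I₁ J₀ J₁ M : ℤ), J₀ ≤ 2 * N → -M ≤ J₀ → 2 * N ≤ M → ∀ (v₀ p₁ q₁ : Site 2) (k₀ : Fin 4) (P : (zdGraph 2).Walk v₀ p₁) (Q : (zdGraph 2).Walk (cFace (v₀, k₀)) q₁), 2 * N ≤ v₀ 1 → (∀ d ∈ P.darts, s(d.fst, d.snd) ∈ β ∨ ¬ (I₀ ≤ d.fst 0 ∧ d.fst 0 ≤ I₁ ∧ J₀ ≤ d.fst 1 ∧ d.fst 1 ≤ J₁) ∨ ¬ (I₀ ≤ d.snd 0 ∧ d.snd 0 ≤ I₁ ∧ J₀ ≤ d.snd 1 ∧ d.snd 1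 ≤ J₁)) → (∀ z ∈ P.support, 2 * N ≤ z 1 ∨ 2 * N ≤ z 0 ∨ z 0 ≤ -(2 * N)) → (∀ z ∈ P.support, -M ≤ z 0 ∧ z 0 ≤ M ∧ J₀ - 1 ≤ z 1 ∧ z 1 ≤ M) → (p₁ 1 < J₀ ∨ p₁ 0 < I₀ ∨ I₁ < p₁ 0) → (∀ d ∈ Q.darts, sepEdge d.fst d.snd ∉ β) → (∀ f ∈ Q.support, 2 * N ≤ f 0 ∨ f 0 + 1 ≤ -(2 * N)) → (∀ f ∈ Q.support, -M ≤ f 0 ∧ f 0 ≤ M ∧ J₀ - 1 ≤ f 1 ∧ f 1 ≤ M) → q₁ 1 = J₀ - 1 → (∀ X : ℤ, -(4 * N) + 1 ≤ X → X ≤ 4 * N - 2 → 2 * I₀ ≤ X → X + 1 ≤ 2 * I₁ → (X + 1 ≤ 2 * q₁ 0 + 1 ↔ ¬ X + 1 ≤ 2 * p₁ 0)) → ∀ (c : Site 2 × Fin 4) (i j : ℕ), i ≤ j → (∀ t, i ≤ t → t ≤ j → I₀ ≤ cFace (cornerOrbit β c t) 0 ∧ cFace (cornerOrbit β c t) 0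 + 1 ≤ I₁ ∧ J₀ ≤ cFace (cornerOrbit β c t) 1 ∧ cFace (cornerOrbit β c t) 1 + 1 ≤ J₁) → ((-(2 * N - 1) ≤ (cornerOrbit β c i).1 0 ∧ (cornerOrbit β c i).1 0 ≤ 2 * N - 1 ∧ -(2 * N - 1) ≤ (cornerOrbit β c i).1 1 ∧ (cornerOrbit β c i).1 1 ≤ 2 * N - 1) ∧ ((cornerOrbit β c j).1 0 ≤ -(M + 2) ∨ M + 2 ≤ (cornerOrbit β c j).1 0 ∨ M + 2 ≤ (cornerOrbit β c j).1 1)) ∨ (((cornerOrbit β c i).1 0 ≤ -(M + 2) ∨ M + 2 ≤ (cornerOrbit β c i).1 0 ∨ M + 2 ≤ (cornerOrbit β c i).1 1) ∧ (-(2 * N - 1) ≤ (cornerOrbit β c j).1 0 ∧ (cornerOrbit β c j).1 0 ≤ 2 * N - 1 ∧ -(2 * N - 1) ≤ (cornerOrbit β c j).1 1 ∧ (cornerOrbit β c j).1 1 ≤ 2 * N - 1)) → ∃ s, i ≤ s ∧ s ≤ j ∧ cornerOrbit β c s = (v₀, k₀) := by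
  intro β N I₀ I₁ J₀ J₁ M hJN hJM hNM v₀ p₁ q₁ k₀ P Q hv₀ hP1 hP2 hP3 hp₁ hQ1 hQ2 hQ3 hq₁ hX c i j hij hin hends
  -- the scaled pieces
  obtain ⟨sP, hsPe, hsPs⟩ := exists_scaleTwo_JF 0 v₀ p₁ P
  obtain ⟨sQ, hsQe, hsQs⟩ := exists_scaleTwo_JF 1 (cFace (v₀, k₀)) q₁ Q
  obtain ⟨ce0, ce1⟩ := centre_coord_JF v₀ k₀
  simp only [Pi.add_apply] at ce0 ce1
  have hcen : cFace (v₀, k₀) + cFace (v₀, k₀) + 1 = v₀ + v₀ + cornerUnit k₀ + cornerUnit (k₀ + 1) := by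
    rw [Site.eq_iff_two]; simp only [Pi.add_apply, Pi.one_apply]; omega
  have hl1 : (zdGraph 2).Adj (cFace (v₀, k₀) + cFace (v₀, k₀) + 1) (v₀ + v₀ + cornerUnit k₀) := by
    rw [hcen, adj_iff_coord_JF]; simp only [Pi.add_apply]
    rcases corner_coord_JF k₀ with h | h | h | h <;> omega
  have hl2 : (zdGraph 2).Adj (v₀ + v₀ + cornerUnit k₀) (v₀ + v₀ + 0) := by
    rw [adj_iff_coord_JF]; simp only [Pi.add_apply, Pi.zero_apply]
    rcases corner_coord_JF k₀ with h | h | h | h <;> omega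
  set link : (zdGraph 2).Walk (cFace (v₀, k₀) + cFace (v₀, k₀) + 1) (v₀ + v₀ + 0) :=
    SimpleGraph.Walk.cons hl1 (SimpleGraph.Walk.cons hl2 SimpleGraph.Walk.nil) with hlink
  have hp₁s : p₁ ∈ P.support := P.end_mem_support
  have hv₀s : v₀ ∈ P.support := P.start_mem_support
  have hq₁s : q₁ ∈ Q.support := Q.end_mem_support
  obtain ⟨kP, hkP⟩ : ∃ kP : ℕ, (kP : ℤ) = 2 * p₁ 1 - 2 * J₀ + 5 :=
    ⟨(2 * p₁ 1 - 2 * J₀ + 5).toNat, by have := (hP3 p₁ hp₁s).2.2.1; omega⟩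
  set legP := downRun (p₁ + p₁ + 0) kP with hlegP
  set legQ := downRun (q₁ + q₁ + 1) 4 with hlegQ
  set Φ := legQ.reverse.append (sQ.reverse.append (link.append (sP.append legP))) with hΦ
  -- endpoints below the box
  have ha : ((fun w : Site 2 => w - Pi.single 1 1)^[4] (q₁ + q₁ + 1)) 1 = 2 * J₀ - 5 := by
    rw [iterate_sub_single_apply_one]; simp only [Pi.add_apply, Pi.one_apply]; push_cast; omega
  have hb : ((fun w : Site 2 => w - Pi.single 1 1)^[kP] (p₁ + p₁ + 0)) 1 = 2 * J₀ - 5 := by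
    rw [iterate_sub_single_apply_one]; simp only [Pi.add_apply, Pi.zero_apply]; omega
  -- membership in the pieces
  have hmemΦ : ∀ e ∈ Φ.edges, e ∈ legQ.edges ∨ e ∈ sQ.edges ∨ e ∈ link.edges ∨ e ∈ sP.edges ∨ e ∈ legP.edges := by
    intro e he
    simp only [hΦ, SimpleGraph.Walk.edges_append, SimpleGraph.Walk.edges_reverse, List.mem_append,
      List.mem_reverse] at he
    tauto
  have hsuppΦ : ∀ z ∈ Φ.support, z ∈ legQ.support ∨ z ∈ sQ.support ∨ z ∈ link.support ∨ z ∈ sP.support ∨ z ∈ legP.support := by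
    intro z hz
    simp only [hΦ, SimpleGraph.Walk.mem_support_append_iff, SimpleGraph.Walk.support_reverse,
      List.mem_reverse] at hz
    tauto
  have hlinke : ∀ e ∈ link.edges, e = s(cFace (v₀, k₀) + cFace (v₀, k₀) + 1, v₀ + v₀ + cornerUnit k₀) ∨
      e = s(v₀ + v₀ + cornerUnit k₀, v₀ + v₀ + 0) := by
    intro e he
    simpa [hlink] using he
  have hlinks : ∀ z ∈ link.support, z = cFace (v₀, k₀) + cFace (v₀, k₀) + 1 ∨ z = v₀ + v₀ + cornerUnit k₀ ∨ z = v₀ + v₀ + 0 := by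
    intro z hz
    simpa [hlink] using hz
  -- (Φ1) the edge typology of the transition lemma
  have hΦ1 : ∀ e ∈ Φ.edges,
      (∃ x y : Site 2, (zdGraph 2).Adj x y ∧ s(x, y) ∈ β ∧ e = s(x + x, x + y)) ∨
      (e = s(v₀ + v₀, v₀ + v₀ + cornerUnit k₀) ∨
        e = s(v₀ + v₀ + cornerUnit k₀, v₀ + v₀ + cornerUnit k₀ + cornerUnit (k₀ + 1))) ∨
      (∃ f f' : Site 2, (zdGraph 2).Adj f f' ∧ sepEdge f f' ∉ β ∧ e = s(f + f + 1, f + f' + 1)) ∨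
      (∃ x ∈ e, ¬ (2 * I₀ ≤ x 0 ∧ x 0 ≤ 2 * I₁ ∧ 2 * J₀ ≤ x 1 ∧ x 1 ≤ 2 * J₁)) := by
    intro e he
    rcases hmemΦ e he with he | he | he | he | he
    · obtain ⟨x, y, rfl, hx, -, -⟩ := exists_eq_of_mem_edges_JF he
      rw [hlegQ, mem_support_downRun] at hx
      simp only [Pi.add_apply, Pi.one_apply] at hx
      exact Or.inr (Or.inr (Or.inr ⟨x, Sym2.mem_mk_left _ _, by omega⟩))
    · obtain ⟨d, hd, he | he⟩ := hsQe e he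
      · exact Or.inr (Or.inr (Or.inl ⟨_, _, d.adj, hQ1 d hd, he⟩))
      · refine Or.inr (Or.inr (Or.inl ⟨d.snd, d.fst, d.adj.symm, by rw [sepEdge_comm]; exact hQ1 d hd, ?_⟩))
        rw [he, Sym2.eq_swap, add_comm d.fst d.snd]
    · rcases hlinke e he with rfl | rfl
      · refine Or.inr (Or.inl (Or.inr ?_))
        rw [hcen, Sym2.eq_swap]
      · refine Or.inr (Or.inl (Or.inl ?_))
        rw [add_zero, Sym2.eq_swap]
    · obtain ⟨d, hd, he⟩ := hsPe e he
      have hadj := d.adj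
      rw [adj_iff_coord_JF] at hadj
      rcases hP1 d hd with hβ | hout | hout
      · rcases he with rfl | rfl
        · exact Or.inl ⟨_, _, d.adj, hβ, by rw [add_zero, add_zero]⟩
        · refine Or.inl ⟨d.snd, d.fst, d.adj.symm, by rw [Sym2.eq_swap]; exact hβ, ?_⟩
          rw [add_zero, add_zero, Sym2.eq_swap, add_comm d.fst d.snd]
      · rcases he with rfl | rfl
        · refine Or.inr (Or.inr (Or.inr ⟨d.fst + d.fst + 0, Sym2.mem_mk_left _ _, ?_⟩))
          simp only [Pi.add_apply, Pi.zero_apply]; omega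
        · refine Or.inr (Or.inr (Or.inr ⟨d.fst + d.snd + 0, Sym2.mem_mk_left _ _, ?_⟩))
          simp only [Pi.add_apply, Pi.zero_apply]; omega
      · rcases he with rfl | rfl
        · refine Or.inr (Or.inr (Or.inr ⟨d.fst + d.snd + 0, Sym2.mem_mk_right _ _, ?_⟩))
          simp only [Pi.add_apply, Pi.zero_apply]; omega
        · refine Or.inr (Or.inr (Or.inr ⟨d.fst + d.snd + 0, Sym2.mem_mk_left _ _, ?_⟩))
          simp only [Pi.add_apply, Pi.zero_apply]; omega
    · obtain ⟨x, y, rfl, hx, -, -⟩ := exists_eq_of_mem_edges_JF he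
      rw [hlegP, mem_support_downRun] at hx
      simp only [Pi.add_apply, Pi.zero_apply] at hx
      exact Or.inr (Or.inr (Or.inr ⟨x, Sym2.mem_mk_left _ _, by omega⟩))
  -- (Φ2) low horizontal edges of the fence are far to the left or to the right
  have hΦ2 : ∀ z : Site 2, s(z, z + Pi.single 0 1) ∈ Φ.edges → z 1 ≤ 4 * N - 2 → 4 * N ≤ z 0 ∨ z 0 + 1 ≤ -(4 * N) := by
    intro z he hz
    rcases hmemΦ _ he with he | he | he | he | he
    · have h1 := legQ.fst_mem_support_of_mem_edges he
      have h2 := legQ.snd_mem_support_of_mem_edges he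
      rw [hlegQ, mem_support_downRun] at h1 h2
      simp only [Pi.add_apply, Pi.one_apply, single_zero_apply_zero] at h1 h2
      omega
    · obtain ⟨d, hd, he⟩ := hsQe _ he
      have hf := hQ2 _ (Q.dart_fst_mem_support_of_mem_darts hd)
      have hf' := hQ2 _ (Q.dart_snd_mem_support_of_mem_darts hd)
      have hadj := d.adj
      rw [adj_iff_coord_JF] at hadj
      rcases he with he | he <;>
      · rw [sym2_eq_iff_coord_JF] at he
        simp only [Pi.add_apply, Pi.one_apply, single_zero_apply_zero, single_zero_apply_one] at he
        omega
    · rcases hlinke _ he with he | he <;>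
      · rw [sym2_eq_iff_coord_JF] at he
        simp only [Pi.add_apply, Pi.one_apply, Pi.zero_apply, single_zero_apply_zero, single_zero_apply_one] at he
        rcases corner_coord_JF k₀ with h | h | h | h <;> omega
    · obtain ⟨d, hd, he⟩ := hsPe _ he
      have hf := hP2 _ (P.dart_fst_mem_support_of_mem_darts hd)
      have hf' := hP2 _ (P.dart_snd_mem_support_of_mem_darts hd)
      have hadj := d.adj
      rw [adj_iff_coord_JF] at hadj
      rcases he with he | he <;>
      · rw [sym2_eq_iff_coord_JF] at he
        simp only [Pi.add_apply, Pi.zero_apply, single_zero_apply_zero, single_zero_apply_one] at he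
        omega
    · have h1 := legP.fst_mem_support_of_mem_edges he
      have h2 := legP.snd_mem_support_of_mem_edges he
      rw [hlegP, mem_support_downRun] at h1 h2
      simp only [Pi.add_apply, Pi.zero_apply, single_zero_apply_zero] at h1 h2
      omega
  -- the support of the fence
  have hsupp : ∀ z ∈ Φ.support, -(2 * M + 2) ≤ z 0 ∧ z 0 ≤ 2 * M + 1 ∧ z 1 ≤ 2 * M + 1 := by
    intro z hz
    rcases hsuppΦ z hz with hz | hz | hz | hz | hz
    · rw [hlegQ, mem_support_downRun] at hz
      simp only [Pi.add_apply, Pi.one_apply] at hz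
      have := hQ3 q₁ hq₁s
      omega
    · rcases hsQs z hz with ⟨f, hf, rfl⟩ | ⟨d, hd, rfl⟩
      · have := hQ3 f hf
        simp only [Pi.add_apply, Pi.one_apply]; omega
      · have h1 := hQ3 _ (Q.dart_fst_mem_support_of_mem_darts hd)
        have h2 := hQ3 _ (Q.dart_snd_mem_support_of_mem_darts hd)
        simp only [Pi.add_apply, Pi.one_apply]; omega
    · have := hP3 v₀ hv₀s
      have hcf : cFace (v₀, k₀) 0 = v₀ 0 - cornerOff k₀ 0 ∧ cFace (v₀, k₀) 1 = v₀ 1 - cornerOff k₀ 1 := by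
        simp [cFace, faceAt]
      rcases hlinks z hz with rfl | rfl | rfl <;>
      · simp only [Pi.add_apply, Pi.one_apply, Pi.zero_apply]
        rcases corner_coord_JF k₀ with h | h | h | h <;> omega
    · rcases hsPs z hz with ⟨x, hx, rfl⟩ | ⟨d, hd, rfl⟩
      · have := hP3 x hx
        simp only [Pi.add_apply, Pi.zero_apply]; omega
      · have h1 := hP3 _ (P.dart_fst_mem_support_of_mem_darts hd)
        have h2 := hP3 _ (P.dart_snd_mem_support_of_mem_darts hd)
        simp only [Pi.add_apply, Pi.zero_apply]; omega
    · rw [hlegP, mem_support_downRun] at hz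
      simp only [Pi.add_apply, Pi.zero_apply] at hz
      have := hP3 p₁ hp₁s
      omega
  -- the winding number on the row `2J₀ - 3` below the box: only the two legs count
  have hbot : ∀ u : Site 2, u 1 = 2 * J₀ - 3 → -(4 * N) + 1 ≤ u 0 → u 0 ≤ 4 * N - 2 → 2 * I₀ ≤ u 0 → u 0 + 1 ≤ 2 * I₁ →
      walkWinding Φ u ≠ 0 := by
    intro u hu1 hu0 hu0' hu2 hu3
    have hXu := hX (u 0) hu0 hu0' hu2 hu3
    have hzero : ∀ {x y : Site 2} (w : (zdGraph 2).Walk x y), (∀ z ∈ w.support, 2 * J₀ - 2 ≤ z 1) → walkWinding w u = 0 :=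
      fun w hw => walkWinding_eq_zero_of_ge hw (by omega)
    have h1 : walkWinding sQ u = 0 := by
      refine hzero sQ fun z hz => ?_
      rcases hsQs z hz with ⟨f, hf, rfl⟩ | ⟨d, hd, rfl⟩
      · have := hQ3 f hf
        simp only [Pi.add_apply, Pi.one_apply]; omega
      · have h1 := hQ3 _ (Q.dart_fst_mem_support_of_mem_darts hd)
        have h2 := hQ3 _ (Q.dart_snd_mem_support_of_mem_darts hd)
        simp only [Pi.add_apply, Pi.one_apply]; omega
    have h2 : walkWinding link u = 0 := by
      refine hzero link fun z hz => ?_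
      have hcf : cFace (v₀, k₀) 1 = v₀ 1 - cornerOff k₀ 1 := by simp [cFace, faceAt]
      rcases hlinks z hz with rfl | rfl | rfl <;>
      · simp only [Pi.add_apply, Pi.one_apply, Pi.zero_apply]
        rcases corner_coord_JF k₀ with h | h | h | h <;> omega
    have h3 : walkWinding sP u = 0 := by
      refine hzero sP fun z hz => ?_
      rcases hsPs z hz with ⟨x, hx, rfl⟩ | ⟨d, hd, rfl⟩
      · have := hP3 x hx
        simp only [Pi.add_apply, Pi.zero_apply]; omega
      · have h1 := hP3 _ (P.dart_fst_mem_support_of_mem_darts hd)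
        have h2 := hP3 _ (P.dart_snd_mem_support_of_mem_darts hd)
        simp only [Pi.add_apply, Pi.zero_apply]; omega
    have h4 : walkWinding legQ u = -(if u 0 + 1 ≤ 2 * q₁ 0 + 1 then 1 else 0) := by
      rw [hlegQ, walkWinding_downRun]
      simp only [Pi.add_apply, Pi.one_apply]
      push_cast
      split_ifs <;> omega
    have h5 : walkWinding legP u = -(if u 0 + 1 ≤ 2 * p₁ 0 then 1 else 0) := by
      have := (hP3 p₁ hp₁s).2.2.1
      rw [hlegP, walkWinding_downRun]
      simp only [Pi.add_apply, Pi.zero_apply]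
      split_ifs <;> omega
    rw [hΦ]
    simp only [walkWinding_append, walkWinding_reverse, h1, h2, h3, h4, h5]
    split_ifs <;> omega
  -- the winding number along the stretch
  by_contra hcon
  push Not at hcon
  have hconst : ∀ t, i ≤ t → t ≤ j →
      walkWinding Φ ((cornerOrbit β c t).1 + cFace (cornerOrbit β c t)) = walkWinding Φ ((cornerOrbit β c i).1 + cFace (cornerOrbit β c i)) := by
    intro t hit htj
    induction t with
    | zero =>
      obtain rfl : i = 0 := by omega
      rfl
    | succ t ih =>
      rcases Nat.eq_or_lt_of_le hit with rfl | hlt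
      · rfl
      · rw [← ih (by omega) (by omega)]
        have hstep : cornerOrbit β c (t + 1) = nextCorner β (cornerOrbit β c t) := rfl
        rw [hstep]
        exact fence_transition_JF β I₀ I₁ J₀ J₁ v₀ k₀ _ _ Φ (by rw [ha]; omega) (by rw [hb]; omega) hΦ1 _
          (hin t (by omega) (by omega)) (by rw [← hstep]; exact hin (t + 1) hit htj)
          (by rw [← hstep]; exact hcon (t + 1) hit htj)
  have hWj := hconst j hij le_rfl
  -- inner corners have winding number `≠ 0`, outer corners `0`
  have hinner : ∀ t, i ≤ t → t ≤ j → (-(2 * N - 1) ≤ (cornerOrbit β c t).1 0 ∧ (cornerOrbit β c t).1 0 ≤ 2 * N - 1 ∧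
      -(2 * N - 1) ≤ (cornerOrbit β c t).1 1 ∧ (cornerOrbit β c t).1 1 ≤ 2 * N - 1) →
      walkWinding Φ ((cornerOrbit β c t).1 + cFace (cornerOrbit β c t)) ≠ 0 := by
    intro t hit htj hv
    have hface := hin t hit htj
    generalize cornerOrbit β c t = ct at hv hface ⊢
    obtain ⟨v, k⟩ := ct
    have hs0 := sq_coord_JF v k 0
    have hs1 := sq_coord_JF v k 1
    have hcf : cFace (v, k) 1 = v 1 - cornerOff k 1 := by simp [cFace, faceAt]
    have h00 := cornerOff_apply_zero_or_one k 0
    have h01 := cornerOff_apply_zero_or_one k 1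
    have hcf0 : cFace (v, k) 0 = v 0 - cornerOff k 0 := by simp [cFace, faceAt]
    dsimp only at hv hface hs0 hs1 ⊢
    exact walkWinding_inner_JF Φ N I₀ I₁ J₀ (by rw [ha]; omega) (by rw [hb]; omega) hΦ2 hbot _ (by omega) (by omega)
      (by omega)
  have houter : ∀ t, i ≤ t → t ≤ j → ((cornerOrbit β c t).1 0 ≤ -(M + 2) ∨ M + 2 ≤ (cornerOrbit β c t).1 0 ∨
      M + 2 ≤ (cornerOrbit β c t).1 1) →
      walkWinding Φ ((cornerOrbit β c t).1 + cFace (cornerOrbit β c t)) = 0 := by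
    intro t hit htj hv
    have hface := hin t hit htj
    generalize cornerOrbit β c t = ct at hv hface ⊢
    obtain ⟨v, k⟩ := ct
    have hs0 := sq_coord_JF v k 0
    have hs1 := sq_coord_JF v k 1
    have hcf : cFace (v, k) 1 = v 1 - cornerOff k 1 := by simp [cFace, faceAt]
    have h00 := cornerOff_apply_zero_or_one k 0
    have h01 := cornerOff_apply_zero_or_one k 1
    dsimp only at hv hface hs0 hs1 ⊢
    exact walkWinding_outer_JF Φ J₀ M (by rw [ha]; omega) (by rw [hb]; omega) hsupp _ (by omega) (by omega)
  rcases hends with ⟨h1, h2⟩ | ⟨h1, h2⟩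
  · exact hinner i le_rfl hij h1 (hWj ▸ houter j hij le_rfl h2)
  · exact hinner j hij le_rfl h2 (hWj.trans (houter i le_rfl hij h1))

end

end Summit.CriticalPhenomena.CardyFormulaZ2.Cruxes.EdgePrecompact.QkzStripBoundaryArm
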